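import Summits.QuantumFields.YangMills.Theorems.BalabanLadderIRAbstractBasinRung24
import HarnessLib

/-!
# Plateau dichotomy for the abstract purity defect: a scale-invariant member is EXACTLY pure or impure beyond `1/24`
(ideator ym-ir-idea-6 g2, lens FSS; independently observed by ym-ir-idea-15 g2 as «C1»)

From the landed quadrupling step `basin_step24` ([Sym]+[TM] only: `boxDefect Z L ≤ u ≤ 1/24 → boxDefect Z (4L) ≤ 10600·u⁴`)
and `10600/24³ < 1`: whenever `0 < boxDefect Z L ≤ 1/24` the defect STRICTLY DECREASES under `L ↦ 4L`; hence a member whose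
defect is invariant under one quadrupling `L ↦ 4L` (in particular an exactly scale-invariant member — e.g. the torus partition
function of a 4D reflection-positive conformal datum restricted to integer boxes) has, at every `L ≥ 8`,
`boxDefect Z L = 0 ∨ 1/24 < boxDefect Z L`.  Reading for the counterexample hunt on `AbstractBasin (1/8) (1/24)` (★ cscan R406,
`Cruxes/IR/BASIN-WINDOW-ym-ir-idea-6.md`): scale-invariant («4D modular») data can never refute a rung at or below `1/24`; a plateau
kill of the `1/8` rung needs a plateau value in `(1/24, 1/8]`.

HONEST FRAMING.  Bookkeeping about the group-free abstract class; nothing here proves the Yang–Mills mass gap (Clay), a lattice gap,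
`BalabanLadder.IR` (stmt-QuantumFields-19354) or its seed; R4 closes only the conditional finite-𝕋⁴ rung `BalabanLadder.UV`.
-/

noncomputable section

open Summit.QuantumFields.YangMills.Cruxes.IR.AspectBootstrap
open Summit.QuantumFields.YangMills.Cruxes.IR.BasinRung

namespace Summit.QuantumFields.YangMills.Cruxes.IR.AspectBootstrap.Ceiling

variable {Z : ℕ → ℕ → ℕ → ℕ → ℝ}

/-- **Strict decrease under quadrupling in the small-defect regime**: `0 < δ(L) ≤ 1/24 ⇒ δ(4L) < δ(L)` ([Sym]+[TM] only). -/
theorem boxDefect_quadruple_lt (hS : IsAxisSymmetric Z) (hT : IsTracePositive Z) (L : ℕ) (hL : 8 ≤ L)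
    (hpos : 0 < boxDefect Z L) (h24 : boxDefect Z L ≤ 1 / 24) : boxDefect Z (4 * L) < boxDefect Z L := by
  have hstep := basin_step24 hS hT L hL le_rfl h24
  have hcube : boxDefect Z L ^ 3 ≤ (1 / 24) ^ 3 := by gcongr
  calc boxDefect Z (4 * L) ≤ 10600 * boxDefect Z L ^ 4 := hstep
    _ = (10600 * boxDefect Z L ^ 3) * boxDefect Z L := by ring
    _ ≤ (10600 * (1 / 24) ^ 3) * boxDefect Z L := by gcongr
    _ < 1 * boxDefect Z L := by gcongr; norm_num
    _ = boxDefect Z L := one_mul _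

/-- **Plateau dichotomy at one scale**: if the defect is invariant under ONE quadrupling `L ↦ 4L` (`L ≥ 8`), it is `0` or `> 1/24`. -/
theorem boxDefect_eq_zero_or_gt_of_quadruple_eq (hS : IsAxisSymmetric Z) (hT : IsTracePositive Z) (L : ℕ) (hL : 8 ≤ L)
    (hinv : boxDefect Z (4 * L) = boxDefect Z L) : boxDefect Z L = 0 ∨ 1 / 24 < boxDefect Z L := by
  have h0 : 0 ≤ boxDefect Z L := boxDefect_nonneg_of_le hT L hL
  by_contra h
  push Not at h
  obtain ⟨hne, hle⟩ := h
  have hpos : 0 < boxDefect Z L := lt_of_le_of_ne h0 (Ne.symm hne)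
  have := boxDefect_quadruple_lt hS hT L hL hpos hle
  rw [hinv] at this
  exact lt_irrefl _ this

/-- **Scale-invariant members**: a constant defect `δ(L) = δ*` for all `L ≥ 8` forces `δ* = 0 ∨ 1/24 < δ*` — «no 4D reflection-positive
scale-invariant datum is nearly-but-not-exactly pure at aspect 4:1 below `1/24`». -/
theorem plateau_dichotomy (hS : IsAxisSymmetric Z) (hT : IsTracePositive Z) {δ : ℝ}
    (hconst : ∀ L : ℕ, 8 ≤ L → boxDefect Z L = δ) : δ = 0 ∨ 1 / 24 < δ := by
  have h := boxDefect_eq_zero_or_gt_of_quadruple_eq hS hT 8 le_rfl (by rw [hconst 8 le_rfl, hconst (4 * 8) (by norm_num)])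
  rwa [hconst 8 le_rfl] at h

/-- Contrapositive packaging for the hunt: a plateau value in `(0, 1/24]` is impossible; in particular no scale-invariant member
refutes `AbstractBasin θ ε` for any `θ ≤ 1/24`. -/
theorem no_plateau_in_window (hS : IsAxisSymmetric Z) (hT : IsTracePositive Z) {δ : ℝ} (hδ0 : 0 < δ) (hδ : δ ≤ 1 / 24) :
    ¬ (∀ L : ℕ, 8 ≤ L → boxDefect Z L = δ) := by
  intro hconst
  rcases plateau_dichotomy hS hT hconst with h | h <;> linarith

end Summit.QuantumFields.YangMills.Cruxes.IR.AspectBootstrap.Ceiling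

end
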